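import Literature.AnabelianGeometry.EtaleTheta.Discharge.Sec5Prop53ChainModelZPrincipal
import HarnessLib

/-!
# [EtTh] §5, Prop. 5.3: the divisor-support vocabulary `DivisorSupportData'` is INHABITED at the `ℤ`-chain model
# (first non-vacuous instance: ℤ-type primes, infinitely supported `div(Θ̈)`, incidence F3 from the dual-graph law (L))

Mochizuki, *The étale theta function …*, Publ. RIMS **45** (2009), §5, proof of Prop. 5.3, pp. 326–327 (PDF pp. 100–101)
[cite: MochizukiEtTh2009, Prop 5.3 proof p.326–327 (PDF pp.100–101)]; Prop. 3.2 (i) p. 296 (PDF p. 70); Prop. 1.4 (i) p. 247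
(PDF p. 21).  Cell abc-iut, layer L2, ROWS #15d R287 «PROP 5.3 (ii)/(iii) NON-VACUOUS WITNESSES» (abc-iut-L2-lead gen 4); seat
abc-iut-w6-d061 (gen 4); NV census v4 row `DivisorSupportData'` (abc-iut-L6-d1's REPAIRED vocabulary, `FrobenioidThetaDivisorSupportR.lean`;
EMPTY at every earlier carrier: perfect `Φ` — abc-iut-f-127 `isEmpty_divisorSupportData'_of_isPerfect` — or finitely supported `Φ`).
At `chainThetaZ` / `chainPrimeDataZ` (`Φ(A_⊚) = ∏_{ℤ⊔ℤ} ℤ_{≥0}`, `div(Θ̈) = 𝟙_cusps`) with `Sec5Prop53ChainModelZPrincipal.lean`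
(F2 `factorZ`/`genZ`, F1 `prinHom`, F3 `incidenceZ`), THIS FILE supplies F6 (translations by `Aut_C(A_⊚) ≅ ℤ`), the `ℤ_{≥0}`-structure
fields (`factor_carrier`, `le_ord_iff`), F5 (`ord_𝔠 𝟙_cusps = 1`), and assembles **`chainSupportZ : DivisorSupportData' chainPrimeDataZ`**,
`nonempty_divisorSupportData'_chainZ`.  HONEST FRAMING: a MODEL instance (joint satisfiability of the twelve typed fields); says
nothing about the tempered Frobenioid of [EtTh] §5 or about [IUTchIII] Cor. 3.12; no side taken; typed ≠ proved.
-/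

noncomputable section

namespace Literature.AnabelianGeometry.EtaleTheta.FrobenioidThetaDivisors.Prop53ChainZ

open CategoryTheory Literature.AlgebraicGeometry.Frobenioids ConstantMultiple ConstantMultiple.Cor512Toy Prop53Toy
  Prop53Chain Sec3Prop34CnstOfRlfRChainModel

/-! ### F6: translations -/

/-- A translated cuspidal prime is cuspidal, and conversely. [cite: MochizukiEtTh2009, §1 p.238 (PDF p.12)] -/
theorem isCuspZ_congr_pullAut_iff (g : Aut chainThetaZ.Acirc) (𝔭 : Primes Φz) :
    IsCuspZ (Primes.congr (chainThetaZ.pullAut g) 𝔭) ↔ IsCuspZ 𝔭 := by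
  unfold IsCuspZ
  rw [idxZ_congr_pullAut]
  rcases idxZ 𝔭 with n | n
  · simp
  · simp

/-- A translated non-cuspidal prime has its label shifted. [cite: MochizukiEtTh2009, §1 p.238 (PDF p.12)] -/
theorem labelZ_congr_pullAut (g : Aut chainThetaZ.Acirc) (𝔭 : Primes Φz) :
    labelZ (Primes.congr (chainThetaZ.pullAut g) 𝔭) = labelZ 𝔭 + Multiplicative.toAdd g.inv := by
  unfold labelZ
  rw [idxZ_congr_pullAut]
  rcases idxZ 𝔭 with n | n
  · simp
  · simp


/-- Every translation of the chain is realised by an automorphism of `A_⊚` (as in f-128's `exists_aut_translate`).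
[cite: MochizukiEtTh2009, §1 p.238 (PDF p.12)] -/
theorem exists_aut_translateZ (k : ℤ) : ∃ g : Aut chainThetaZ.Acirc, Multiplicative.toAdd g.inv = k :=
  ⟨⟨Multiplicative.ofAdd (-k), Multiplicative.ofAdd k,
    by rw [SingleObj.comp_as_mul, SingleObj.id_as_one, ← ofAdd_add, add_neg_cancel, ofAdd_zero],
    by rw [SingleObj.comp_as_mul, SingleObj.id_as_one, ← ofAdd_add, neg_add_cancel, ofAdd_zero]⟩, rfl⟩

/-- Divisibility in `ℤ_{≥0}` (multiplicatively) is `≤`. [folklore] -/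
private theorem mulNat_dvd_iff (x y : Multiplicative ℕ) : x ∣ y ↔ Multiplicative.toAdd x ≤ Multiplicative.toAdd y := by
  constructor
  · rintro ⟨c, rfl⟩
    exact Nat.le_add_right _ _
  · intro h
    exact ⟨Multiplicative.ofAdd (Multiplicative.toAdd y - Multiplicative.toAdd x), by
      apply Multiplicative.toAdd.injective
      rw [toAdd_mul, toAdd_ofAdd, Nat.add_sub_cancel' h]⟩

/-! ### The remaining fields, over `Φz` -/

/-- F2: the factorization homomorphism is injective. [cite: MochizukiFrdI2008, Def. 2.4(i) p.47] -/
theorem factorZ_injective : Function.Injective factorZ := fun a b h => by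
  funext i
  have h1 := congrFun h (PZ i)
  rw [factorZ_apply, factorZ_apply, idxZ_PZ] at h1
  exact castQ_injective h1

/-- F2: the coordinates are non-negative. [cite: MochizukiFrdI2008, Def. 2.4(i) p.47] -/
theorem factorZ_nonneg (a : Φz) (𝔭 : Primes Φz) : 0 ≤ Multiplicative.toAdd (factorZ a 𝔭) := by
  rw [factorZ_apply, toAdd_castQ]
  exact Nat.cast_nonneg _

/-- `gen 𝔭` has order `1` at `𝔭`. [cite: MochizukiEtTh2009, Prop 5.3 p.325 (PDF p.99)] -/
theorem factorZ_genZ_self (𝔭 : Primes Φz) : factorZ (genZ 𝔭) 𝔭 = Multiplicative.ofAdd 1 := by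
  rw [factorZ_apply, genZ, Pi.mulSingle_eq_same]
  rfl

/-- `gen 𝔭` has order `0` elsewhere. [cite: MochizukiEtTh2009, Prop 5.3 p.325 (PDF p.99)] -/
theorem factorZ_genZ_of_ne {𝔭 𝔮 : Primes Φz} (h : 𝔮 ≠ 𝔭) : factorZ (genZ 𝔭) 𝔮 = 1 := by
  rw [factorZ_apply, genZ, Pi.mulSingle_eq_of_ne (idxZ_injective.ne h), map_one]

/-- The primary elements of `𝔭` are exactly the positive multiples of `gen 𝔭` (`Φ_𝔭 ≅ ℤ_{≥0}`). [cite: MochizukiFrdI2008, Def. 2.4(i) p.47] -/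
theorem factorZ_carrier (𝔭 : Primes Φz) (a : Φz) :
    a ∈ 𝔭.carrier ↔ ∃ n : ℕ, 0 < n ∧ factorZ a 𝔭 = Multiplicative.ofAdd (n : ℚ) ∧
      ∀ 𝔮 : Primes Φz, 𝔮 ≠ 𝔭 → factorZ a 𝔮 = 1 := by
  constructor
  · intro ha
    obtain ⟨ha1, ha2⟩ := eq_mulSingle_of_mem_carrier ha
    refine ⟨Multiplicative.toAdd (a (idxZ 𝔭)), Nat.pos_of_ne_zero fun h => ha2 (Multiplicative.toAdd.injective h),
      rfl, fun 𝔮 hq => ?_⟩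
    rw [factorZ_apply, ha1, Pi.mulSingle_eq_of_ne (idxZ_injective.ne hq), map_one]
  · rintro ⟨m, hm, hfa, hother⟩
    rw [mem_carrier_iff]
    ext i
    rw [mem_dsupp_iff, Set.mem_singleton_iff]
    constructor
    · intro hi
      by_contra hne
      have h := hother (PZ i) (fun e => hne (by rw [← e, idxZ_PZ]))
      rw [factorZ_apply, idxZ_PZ, castQ_eq_one_iff] at h
      exact hi h
    · rintro rfl
      intro h
      rw [factorZ_apply, h, map_one] at hfa
      have h1 := congrArg Multiplicative.toAdd hfa
      rw [toAdd_one, toAdd_ofAdd] at h1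
      have : (m : ℚ) = 0 := h1.symm
      exact hm.ne' (by exact_mod_cast this)

/-- F2 (`le_ord_iff`): `(c/m)·gen_𝔭 ≤ a` in `Φ^pf` iff `gen_𝔭^c ∣ a^m` in `Φ`. [cite: MochizukiFrdI2008, Def. 2.4(i) p.47] -/
theorem le_ord_iffZ (𝔭 : Primes Φz) (a : Φz) (c m : ℕ) (_hm : 0 < m) :
    ((c : ℚ) ≤ m * Multiplicative.toAdd (factorZ a 𝔭)) ↔ genZ 𝔭 ^ c ∣ a ^ m := by
  rw [factorZ_apply, toAdd_castQ, PiMonoprime.dvd_iff]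
  constructor
  · intro h i
    rw [Pi.pow_apply, Pi.pow_apply, genZ]
    by_cases hi : i = idxZ 𝔭
    · subst hi
      rw [Pi.mulSingle_eq_same, mulNat_dvd_iff, toAdd_pow, toAdd_pow, toAdd_ofAdd, smul_eq_mul, smul_eq_mul, mul_one]
      exact_mod_cast h
    · rw [Pi.mulSingle_eq_of_ne hi, one_pow]
      exact one_dvd _
  · intro h
    have h1 := h (idxZ 𝔭)
    rw [Pi.pow_apply, Pi.pow_apply, genZ, Pi.mulSingle_eq_same, mulNat_dvd_iff, toAdd_pow, toAdd_pow, toAdd_ofAdd,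
      smul_eq_mul, smul_eq_mul, mul_one] at h1
    exact_mod_cast h1

/-- F5: `div(Θ̈) = 𝟙_cusps` has order exactly `1` at every cuspidal prime. [cite: MochizukiEtTh2009, Prop 1.4 (i) p.247 (PDF p.21)] -/
theorem ordGp_divTheta_cuspZ (𝔠 : Primes Φz) (h𝔠 : IsCuspZ 𝔠) :
    ordGpOf' factorZ 𝔠 (Algebra.GrothendieckGroup.of cuspOne) = Multiplicative.ofAdd 1 := by
  obtain ⟨i, hi⟩ := h𝔠
  rw [ordGpOf'_factorZ_of, hi, cuspOne_inr]
  rfl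

/-- F6: every translation `t` of the chain is realised by some `g ∈ Aut_C(A_⊚)`, preserving cuspidality and shifting labels.
[cite: MochizukiEtTh2009, §1 p.238 (PDF p.12)] -/
theorem exists_translateZ (t : ℤ) : ∃ g : Aut chainThetaZ.Acirc,
    (∀ 𝔭, chainPrimeDataZ.IsCuspidal (Primes.congr (chainThetaZ.pullAut g) 𝔭) ↔ chainPrimeDataZ.IsCuspidal 𝔭) ∧
    ∀ (𝔭 : Primes Φz) (h𝔭 : ¬ chainPrimeDataZ.IsCuspidal 𝔭)
      (h𝔭' : ¬ chainPrimeDataZ.IsCuspidal (Primes.congr (chainThetaZ.pullAut g) 𝔭)),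
      chainPrimeDataZ.ncspEquivZ ⟨Primes.congr (chainThetaZ.pullAut g) 𝔭, h𝔭'⟩ = chainPrimeDataZ.ncspEquivZ ⟨𝔭, h𝔭⟩ + t := by
  obtain ⟨g, hg⟩ := exists_aut_translateZ t
  refine ⟨g, fun 𝔭 => isCuspZ_congr_pullAut_iff g 𝔭, fun 𝔭 h𝔭 h𝔭' => ?_⟩
  show labelZ _ = labelZ 𝔭 + t
  rw [labelZ_congr_pullAut, hg]

/-! ### The instance -/

/-- **`DivisorSupportData'` IS INHABITED at the `ℤ`-chain model** — all twelve fields: F2 `factor` (injective, `≥ 0`), `gen`, `factor_gen_*`,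
`factor_carrier`, `le_ord_iff` (the `ℤ_{≥0}`-structure of each factor); F1 `principal = {[(φ, −Δ²φ)]}`; F3 `incidence` (`incidenceZ`, from the
law (L)); F5 `ord_𝔠 div(Θ̈) = 1` at every cusp; F6 translations. [cite: MochizukiEtTh2009, Prop 5.3 proof p.326–327 (PDF pp.100–101)] -/
def chainSupportZ : DivisorSupportData' chainPrimeDataZ where
  factor := factorZ
  factor_injective := factorZ_injective
  factor_nonneg := factorZ_nonneg
  gen := genZ
  factor_gen_self := factorZ_genZ_self
  factor_gen_of_ne h := factorZ_genZ_of_ne h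
  factor_carrier := factorZ_carrier
  le_ord_iff := le_ord_iffZ
  principal := prinHom.range
  incidence 𝔞 𝔫 h𝔫 a b n h𝔞 ha hn hb hcop _ hlin := incidenceZ 𝔞 𝔫 h𝔫 a b n h𝔞 ha hn hb hcop hlin
  ordGp_divTheta_cusp := ordGp_divTheta_cuspZ
  exists_translate := exists_translateZ

/-- **[EtTh] Prop. 5.3, divisor-support vocabulary: NON-VACUOUS** — `DivisorSupportData' chainPrimeDataZ` is inhabited (ℤ-type primes,
infinitely many; infinitely supported `div(Θ̈)`; F3 from the law (L)). [cite: MochizukiEtTh2009, Prop 5.3 proof p.326 (PDF p.100)] -/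
theorem nonempty_divisorSupportData'_chainZ : Nonempty (DivisorSupportData' chainPrimeDataZ) := ⟨chainSupportZ⟩

end Literature.AnabelianGeometry.EtaleTheta.FrobenioidThetaDivisors.Prop53ChainZ

end
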